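/-
Copyright (c) 2026 the pub-hodgecm-mathlib formalisation cell (harness21).  Prover seat hodgecm-mathlib-LD1-p02 (g4), FLOOR 0, programme P6,
half-A line LD1 of crux `hLiu418`, brick (Gα-C∞) `ArchLadder`, plate (P4) «ι-step», sub-brick (P4c) index bookkeeping.  KERNEL module: THEOREMS ONLY
(no definition, no named fact, no `sorry`, no instance, no notation).
-/
import Literature.NumberTheory.Weil1964.ArchUnitaryWeilHalf
import Literature.RepresentationTheory.KonnoKonno2007.JunctionVacuumSectionSwap
import Literature.RepresentationTheory.KonnoKonno2007.JunctionSqueezedVacuum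
import HarnessLib

/-!
# Entries of the relabelled Siegel frame and plane weights of a junction with trivial partner, and where the sign-sorted relabelling `archIdx`
# sends a coordinate ([Folland1989, §4.2 (4.24), Prop. (4.39)]; [KonnoKonno2007, §3.1, §3.3]; [Weil1964, Chap. III n° 37])

Topic `NumberTheory/Weil1964`; namespaces `Literature.RepresentationTheory.KonnoKonno2007.RealDualPair` (§1) and `Literature.NumberTheory.Weil1964` (§2).
KERNEL ONLY: proved theorems; 0 definitions, 0 records, 0 `sorry`.  Index bookkeeping for the «ι-step» of brick (Gα-C∞) `ArchLadder` of line LD1 (crux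
`hLiu418`, cell hodgecm-mathlib), consumed by ★ `DoubledWeilRepresentationArchPlaceBoostBox`:

* §1 along ANY junction presentation `ε : σ ≃ DPIdx P Q 1 ∅`: **`dilWt_apply_equiv`** — the plane weight `dilWt c (ε z)` is `c` exactly at the two plane
  coordinates `ε⁻¹(idxP), ε⁻¹(idxQ)` and `1` elsewhere; **`reindexUnitary_frameU_apply`** — the entries `(frameU^ε)_{z z′}` of the relabelled Siegel frame
  (★ `frame_ll`, ★ `frame_rr`: the `ℤ[i]/2` block on the plane rows, the identity elsewhere);
* §2 **`archIdx_eq_idxP_iff`** ∕ **`archIdx_eq_idxQ_iff`** — `archIdx (j, v) = idxP ⟨v₀, j₀⟩ ↔ v = v₀ ∧ j = j₀`; and for the sign-split presentation of `Fin N`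
  itself **`signSplit_trans_unitJunctionIdx_eq_idxP_iff`** ∕ `…_idxQ_iff`.

Nothing of [Liu2021] is asserted; HC_CM is NOT proved here or anywhere in the tree.

References: [Folland1989] G. B. Folland, *Harmonic Analysis in Phase Space* (1989), §4.2 (4.24), Prop. (4.39); [KonnoKonno2007] K. Konno, T. Konno,
Kyushu J. Math. 61 (2007), §3.1 (3.1), §3.3; [Weil1964] A. Weil, Acta Math. 111 (1964), Chap. III n° 37.
-/

set_option autoImplicit false

noncomputable section

open scoped Matrix
open Complex

/-! ## §1 Entries of the relabelled Siegel frame and plane weights of a junction with trivial partner -/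

namespace Literature.RepresentationTheory.KonnoKonno2007

namespace RealDualPair

open Literature.Analysis.SegalBargmann Literature.RepresentationTheory.HeisenbergGroup

section Entries

variable {σ P Q : Type} [DecidableEq σ] [DecidableEq P] [DecidableEq Q] (p₀ : P) (q₀ : Q)

/-- **the plane weights along a junction presentation**: `dilWt c (ε z) = c` exactly at the two coordinates `ε⁻¹(idxP), ε⁻¹(idxQ)` of the plane,
`1` elsewhere. [cite: Folland1989, §4.2 (4.24)] -/
theorem dilWt_apply_equiv (ε : σ ≃ DPIdx P Q Unit Empty) (c : ℝ) (z : σ) :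
    dilWt Unit Empty p₀ q₀ c (ε z) =
      if z = ε.symm (idxP Unit Empty p₀ ()) ∨ z = ε.symm (idxQ Unit Empty q₀ ()) then c else 1 := by
  rcases h : ε z with ((⟨p, r⟩ | ⟨q, s⟩) | (⟨p, s⟩ | ⟨q, r⟩))
  · obtain rfl : r = () := rfl
    rw [dilWt, planeInd_ll]
    by_cases hp : p = p₀
    · subst hp
      have hz : z = ε.symm (idxP Unit Empty p ()) := (Equiv.eq_symm_apply ε).2 h
      rw [if_pos rfl, if_pos (Or.inl hz), mul_one, add_sub_cancel]
    · have hz1 : ¬z = ε.symm (idxP Unit Empty p₀ ()) := fun hz => by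
        have h' := (Equiv.eq_symm_apply ε).1 hz
        rw [h] at h'
        exact hp (by simpa [idxP] using h')
      have hz2 : ¬z = ε.symm (idxQ Unit Empty q₀ ()) := fun hz => by
        have h' := (Equiv.eq_symm_apply ε).1 hz
        rw [h] at h'
        exact Sum.inl_ne_inr h'
      rw [if_neg hp, mul_zero, add_zero, if_neg (not_or.2 ⟨hz1, hz2⟩)]
  · exact s.elim
  · exact s.elim
  · obtain rfl : r = () := rfl
    rw [dilWt, planeInd_rr]
    by_cases hq : q = q₀
    · subst hq
      have hz : z = ε.symm (idxQ Unit Empty q ()) := (Equiv.eq_symm_apply ε).2 h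
      rw [if_pos rfl, if_pos (Or.inr hz), mul_one, add_sub_cancel]
    · have hz1 : ¬z = ε.symm (idxP Unit Empty p₀ ()) := fun hz => by
        have h' := (Equiv.eq_symm_apply ε).1 hz
        rw [h] at h'
        exact Sum.inr_ne_inl h'
      have hz2 : ¬z = ε.symm (idxQ Unit Empty q₀ ()) := fun hz => by
        have h' := (Equiv.eq_symm_apply ε).1 hz
        rw [h] at h'
        exact hq (by simpa [idxQ] using h')
      rw [if_neg hq, mul_zero, add_zero, if_neg (not_or.2 ⟨hz1, hz2⟩)]

variable [Fintype P] [Fintype Q]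

/-- **the entries of the relabelled Siegel frame** `(frameU^ε)_{z z′} = u_{ε z, ε z′}` along a junction presentation with trivial partner: on the plane
rows `ε z ∈ {idxP, idxQ}` the `ℤ[i]/2` entries of ★ `frame`, the identity elsewhere. [cite: Folland1989, §4.2 Prop. (4.39)] [cite: KonnoKonno2007, §3.3] -/
theorem reindexUnitary_frameU_apply [Fintype σ] (ε : σ ≃ DPIdx P Q Unit Empty) (z z' : σ) :
    ((reindexUnitary ε (frameU Unit Empty p₀ q₀) : Matrix.unitaryGroup σ ℂ) : Matrix σ σ ℂ) z z' =
      if ε z = idxP Unit Empty p₀ () then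
        (((1 / 2 : ℝ) : ℂ) + ((1 / 2 : ℝ) : ℂ) * I) * (if ε z' = idxP Unit Empty p₀ () then 1 else 0)
            - (((1 / 2 : ℝ) : ℂ) + ((1 / 2 : ℝ) : ℂ) * I) * (if ε z' = idxQ Unit Empty q₀ () then 1 else 0)
      else if ε z = idxQ Unit Empty q₀ () then
        (((1 / 2 : ℝ) : ℂ) - ((1 / 2 : ℝ) : ℂ) * I) * (if ε z' = idxP Unit Empty p₀ () then 1 else 0)
            + (((1 / 2 : ℝ) : ℂ) - ((1 / 2 : ℝ) : ℂ) * I) * (if ε z' = idxQ Unit Empty q₀ () then 1 else 0)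
      else if ε z' = ε z then 1 else 0 := by
  rw [reindexUnitary_apply, coe_frameU]
  rcases h : ε z with ((⟨p, r⟩ | ⟨q, s⟩) | (⟨p, s⟩ | ⟨q, r⟩))
  · obtain rfl : r = () := rfl
    rw [frame_ll]
    by_cases hp : p = p₀
    · subst hp
      rw [if_pos rfl, if_pos (show (Sum.inl (Sum.inl (p, ())) : DPIdx P Q Unit Empty) = idxP Unit Empty p () from rfl)]
      rfl
    · have h1 : ¬(Sum.inl (Sum.inl (p, ())) : DPIdx P Q Unit Empty) = idxP Unit Empty p₀ () := fun h1 => hp (by simpa [idxP] using h1)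
      have h2 : ¬(Sum.inl (Sum.inl (p, ())) : DPIdx P Q Unit Empty) = idxQ Unit Empty q₀ () := fun h2 => Sum.inl_ne_inr h2
      rw [if_neg hp, if_neg h1, if_neg h2]
  · exact s.elim
  · exact s.elim
  · obtain rfl : r = () := rfl
    rw [frame_rr]
    by_cases hq : q = q₀
    · subst hq
      have h1 : ¬(Sum.inr (Sum.inr (q, ())) : DPIdx P Q Unit Empty) = idxP Unit Empty p₀ () := fun h1 => Sum.inr_ne_inl h1
      rw [if_pos rfl, if_neg h1, if_pos (show (Sum.inr (Sum.inr (q, ())) : DPIdx P Q Unit Empty) = idxQ Unit Empty q () from rfl)]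
      rfl
    · have h1 : ¬(Sum.inr (Sum.inr (q, ())) : DPIdx P Q Unit Empty) = idxP Unit Empty p₀ () := fun h1 => Sum.inr_ne_inl h1
      have h2 : ¬(Sum.inr (Sum.inr (q, ())) : DPIdx P Q Unit Empty) = idxQ Unit Empty q₀ () := fun h2 => hq (by simpa [idxQ] using h2)
      rw [if_neg hq, if_neg h1, if_neg h2]

end Entries

end RealDualPair

end Literature.RepresentationTheory.KonnoKonno2007

/-! ## §2 Where the sign-sorted relabelling `archIdx` sends a coordinate -/

namespace Literature.NumberTheory.Weil1964

section ArchIdx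

open Literature.RepresentationTheory.KonnoKonno2007 Literature.RepresentationTheory.KonnoKonno2007.RealDualPair
open Literature.Analysis.SegalBargmann
open NumberField NumberField.InfinitePlace

variable {F : Type} [Field F] (E : Type) [Field E] (N : ℕ)
  (wOf : {v : InfinitePlace F // v.IsReal} → {w : InfinitePlace E // w.IsComplex}) (t₀ : Fin N → F) {δ : E}

/-- equality of dependent pairs `⟨v, a⟩ = ⟨v₀, ⟨j₀, H⟩⟩` in `Σ v, {j // p v j}` is `v = v₀ ∧ a.1 = j₀`. [folklore] -/
private theorem sigma_subtype_mk_eq_iff' {o : Type} {m : ℕ} {p : o → Fin m → Prop} {v v₀ : o} (a : {j // p v j}) {j₀ : Fin m}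
    (H : p v₀ j₀) : (⟨v, a⟩ : Σ w, {j // p w j}) = ⟨v₀, ⟨j₀, H⟩⟩ ↔ v = v₀ ∧ a.1 = j₀ := by
  constructor
  · intro h
    have hv : v = v₀ := congrArg Sigma.fst h
    subst hv
    rw [Sigma.mk.inj_iff, heq_iff_eq] at h
    exact ⟨rfl, congrArg Subtype.val h.2⟩
  · rintro ⟨hv, hj⟩
    subst hv
    have ha : a = ⟨j₀, H⟩ := Subtype.ext hj
    subst ha
    rfl

/-- **`archIdx (j, v) = idxP ⟨v₀, j₀⟩ ↔ v = v₀ ∧ j = j₀`** (`j₀` positive at `v₀`). [cite: Weil1964, Chap. III n° 37] [cite: KonnoKonno2007, §3.1] -/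
theorem archIdx_eq_idxP_iff (j : Fin N) (v v₀ : {v : InfinitePlace F // v.IsReal}) (j₀ : Fin N) (H : 0 < signVec wOf t₀ δ v₀ j₀) :
    archIdx E N wOf t₀ (δ := δ) (j, v) =
        idxP Unit Empty (⟨v₀, ⟨j₀, H⟩⟩ : Σ w, PosIdx (signVec wOf t₀ δ w)) () ↔ v = v₀ ∧ j = j₀ := by
  show unitJunctionIdx _ _ (Equiv.sigmaSumDistrib (fun w => PosIdx (signVec wOf t₀ δ w)) (fun w => NegIdx (signVec wOf t₀ δ w))
      ⟨v, signSplit (signVec wOf t₀ δ v) j⟩) =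
      Sum.inl (Sum.inl ((⟨v₀, ⟨j₀, H⟩⟩ : Σ w, PosIdx (signVec wOf t₀ δ w)), ())) ↔ _
  by_cases h : 0 < signVec wOf t₀ δ v j
  · rw [signSplit, Equiv.sumCompl_symm_apply_of_pos (p := fun i => 0 < signVec wOf t₀ δ v i) h]
    show Sum.inl (Sum.inl ((⟨v, ⟨j, h⟩⟩ : Σ w, PosIdx (signVec wOf t₀ δ w)), ())) =
        Sum.inl (Sum.inl ((⟨v₀, ⟨j₀, H⟩⟩ : Σ w, PosIdx (signVec wOf t₀ δ w)), ())) ↔ _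
    rw [Sum.inl.injEq, Sum.inl.injEq, Prod.mk.injEq, sigma_subtype_mk_eq_iff' (p := fun w i => 0 < signVec wOf t₀ δ w i) ⟨j, h⟩ H]
    exact ⟨fun h' => h'.1, fun h' => ⟨h', rfl⟩⟩
  · rw [signSplit, Equiv.sumCompl_symm_apply_of_neg (p := fun i => 0 < signVec wOf t₀ δ v i) h]
    show Sum.inr (Sum.inr ((⟨v, ⟨j, h⟩⟩ : Σ w, NegIdx (signVec wOf t₀ δ w)), ())) =
        Sum.inl (Sum.inl ((⟨v₀, ⟨j₀, H⟩⟩ : Σ w, PosIdx (signVec wOf t₀ δ w)), ())) ↔ _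
    constructor
    · exact fun h' => absurd h' Sum.inr_ne_inl
    · rintro ⟨rfl, rfl⟩
      exact absurd H h

/-- **`archIdx (j, v) = idxQ ⟨v₀, j₀⟩ ↔ v = v₀ ∧ j = j₀`** (`j₀` non-positive at `v₀`). [cite: Weil1964, Chap. III n° 37] [cite: KonnoKonno2007, §3.1] -/
theorem archIdx_eq_idxQ_iff (j : Fin N) (v v₀ : {v : InfinitePlace F // v.IsReal}) (j₀ : Fin N) (H : ¬0 < signVec wOf t₀ δ v₀ j₀) :
    archIdx E N wOf t₀ (δ := δ) (j, v) =
        idxQ Unit Empty (⟨v₀, ⟨j₀, H⟩⟩ : Σ w, NegIdx (signVec wOf t₀ δ w)) () ↔ v = v₀ ∧ j = j₀ := by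
  show unitJunctionIdx _ _ (Equiv.sigmaSumDistrib (fun w => PosIdx (signVec wOf t₀ δ w)) (fun w => NegIdx (signVec wOf t₀ δ w))
      ⟨v, signSplit (signVec wOf t₀ δ v) j⟩) =
      Sum.inr (Sum.inr ((⟨v₀, ⟨j₀, H⟩⟩ : Σ w, NegIdx (signVec wOf t₀ δ w)), ())) ↔ _
  by_cases h : 0 < signVec wOf t₀ δ v j
  · rw [signSplit, Equiv.sumCompl_symm_apply_of_pos (p := fun i => 0 < signVec wOf t₀ δ v i) h]
    show Sum.inl (Sum.inl ((⟨v, ⟨j, h⟩⟩ : Σ w, PosIdx (signVec wOf t₀ δ w)), ())) =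
        Sum.inr (Sum.inr ((⟨v₀, ⟨j₀, H⟩⟩ : Σ w, NegIdx (signVec wOf t₀ δ w)), ())) ↔ _
    constructor
    · exact fun h' => absurd h' Sum.inl_ne_inr
    · rintro ⟨rfl, rfl⟩
      exact absurd h H
  · rw [signSplit, Equiv.sumCompl_symm_apply_of_neg (p := fun i => 0 < signVec wOf t₀ δ v i) h]
    show Sum.inr (Sum.inr ((⟨v, ⟨j, h⟩⟩ : Σ w, NegIdx (signVec wOf t₀ δ w)), ())) =
        Sum.inr (Sum.inr ((⟨v₀, ⟨j₀, H⟩⟩ : Σ w, NegIdx (signVec wOf t₀ δ w)), ())) ↔ _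
    rw [Sum.inr.injEq, Sum.inr.injEq, Prod.mk.injEq, sigma_subtype_mk_eq_iff' (p := fun w i => ¬0 < signVec wOf t₀ δ w i) ⟨j, h⟩ H]
    exact ⟨fun h' => h'.1, fun h' => ⟨h', rfl⟩⟩

omit [Field F] [Field E] in
/-- **the sign-split junction presentation of `Fin N` itself**: `(unitJunctionIdx ∘ signSplit x) i = idxP ⟨k, h⟩ ↔ i = k`.
[cite: KonnoKonno2007, §3.1] -/
theorem signSplit_trans_unitJunctionIdx_eq_idxP_iff (x : Fin N → ℝ) (i k : Fin N) (hk : 0 < x k) :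
    ((signSplit x).trans (unitJunctionIdx _ _)) i = idxP Unit Empty (⟨k, hk⟩ : PosIdx x) () ↔ i = k := by
  rw [Equiv.trans_apply]
  show unitJunctionIdx _ _ (signSplit x i) = Sum.inl (Sum.inl ((⟨k, hk⟩ : PosIdx x), ())) ↔ _
  by_cases h : 0 < x i
  · rw [signSplit, Equiv.sumCompl_symm_apply_of_pos (p := fun i => 0 < x i) h]
    show Sum.inl (Sum.inl ((⟨i, h⟩ : PosIdx x), ())) = Sum.inl (Sum.inl ((⟨k, hk⟩ : PosIdx x), ())) ↔ _
    rw [Sum.inl.injEq, Sum.inl.injEq, Prod.mk.injEq, Subtype.mk.injEq]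
    exact ⟨fun h' => h'.1, fun h' => ⟨h', rfl⟩⟩
  · rw [signSplit, Equiv.sumCompl_symm_apply_of_neg (p := fun i => 0 < x i) h]
    show Sum.inr (Sum.inr ((⟨i, h⟩ : NegIdx x), ())) = Sum.inl (Sum.inl ((⟨k, hk⟩ : PosIdx x), ())) ↔ _
    constructor
    · exact fun h' => absurd h' Sum.inr_ne_inl
    · rintro rfl
      exact absurd hk h

omit [Field F] [Field E] in
/-- … and `= idxQ ⟨k, h⟩ ↔ i = k`. [cite: KonnoKonno2007, §3.1] -/
theorem signSplit_trans_unitJunctionIdx_eq_idxQ_iff (x : Fin N → ℝ) (i k : Fin N) (hk : ¬0 < x k) :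
    ((signSplit x).trans (unitJunctionIdx _ _)) i = idxQ Unit Empty (⟨k, hk⟩ : NegIdx x) () ↔ i = k := by
  rw [Equiv.trans_apply]
  show unitJunctionIdx _ _ (signSplit x i) = Sum.inr (Sum.inr ((⟨k, hk⟩ : NegIdx x), ())) ↔ _
  by_cases h : 0 < x i
  · rw [signSplit, Equiv.sumCompl_symm_apply_of_pos (p := fun i => 0 < x i) h]
    show Sum.inl (Sum.inl ((⟨i, h⟩ : PosIdx x), ())) = Sum.inr (Sum.inr ((⟨k, hk⟩ : NegIdx x), ())) ↔ _
    constructor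
    · exact fun h' => absurd h' Sum.inl_ne_inr
    · rintro rfl
      exact absurd h hk
  · rw [signSplit, Equiv.sumCompl_symm_apply_of_neg (p := fun i => 0 < x i) h]
    show Sum.inr (Sum.inr ((⟨i, h⟩ : NegIdx x), ())) = Sum.inr (Sum.inr ((⟨k, hk⟩ : NegIdx x), ())) ↔ _
    rw [Sum.inr.injEq, Sum.inr.injEq, Prod.mk.injEq, Subtype.mk.injEq]
    exact ⟨fun h' => h'.1, fun h' => ⟨h', rfl⟩⟩

end ArchIdx

end Literature.NumberTheory.Weil1964

end
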